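/-
Copyright (c) 2026 the pub-hodgecm-mathlib formalisation cell (harness21).  Prover seat hodgecm-mathlib-K2Liu-p08 (g6), Track B «K2-LIT»,
#184♮ = hLiu418 = `stmt-HodgeConjecture-24832`; #42S BLOCK D, row D-2, (σ-A) mini-road (LEAD F0P6-plan (g15) RULING M-160f ∕ BATCH #238; (σ-A) road desk
K2Liu-p25 (g3)), brick (an-3a): THE ADAPTED FRAME OF AN INVERTIBLE MINOR — the explicit `A` of ★ (an-2) `K2LiuCornerZetaStageInversion`'s frame letter.
THEOREMS ONLY (no `def`, no `instance`, no `notation`, no named-fact hypothesis, no `sorry`, default heartbeats).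
-/
import Summits.HodgeConjecture.HodgeConjecture.Theorems.K2LiuLocalPiGlueFubini   -- ★ p864190: glue algebra (`glue_add`, `glue_sub`, `glue_smul`, `dotProduct_glue`)
import Mathlib.LinearAlgebra.Matrix.NonsingularInverse
import Mathlib.LinearAlgebra.Determinant
import HarnessLib

/-!
# Crux `HLiu418`, #42S BLOCK D, row D-2, (σ-A) brick (an-3a): THE ADAPTED FRAME OF AN INVERTIBLE MINOR

Cell `hodgecm-mathlib`, crux item hLiu418 = `stmt-HodgeConjecture-24832` (helper lane `--supports … --as helper`, count-neutral; closes no socket); squad K2 ∕ K2Liu (L1).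
Prover K2Liu-p08 (g6) = pen of [A4]∕(an-3) under the (σ-A) road desk K2Liu-p25 (g3).

THE POINT.  ★ (an-2) `K2LiuCornerZetaStageInversion` (K2Liu-p12) turns the ζ-stage `∫_ζ 𝓕G(Z ζ) dμ^κ` into the integral of `G` over the kernel hyperplane of
`Zᵀ`, GIVEN an ADAPTED FRAME: a linear automorphism `A` of `F^{ι₁}` with the ONE letter `hA : ∀ t ζ, A t ⬝ᵥ Z ζ = resL eA t ⬝ᵥ ζ` (`Zᵀ ∘ A = pr_κ` along an
adapted splitting `eA : κ ⊕ ι₂ ≃ ι₁`).  For the assembly (an-3) the frame must be EXPLICIT and vary measurably with the cone variable `s` (`Z = Z_s` is linear in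
`s`).  THIS FILE builds it from an invertible minor, with rational entries:
* §1 the transpose `Zᵀ` in block form: with `ZJ k k′ := (Z e_k)_{eA(inl k′)}` (the `κ × κ` MINOR of `Zᵀ` on the `κ`-block of `eA`) and `ZR k j := (Z e_k)_{eA(inr j)}`,
  **`t ⬝ᵥ Z ζ = (ZJ *ᵥ resL eA t + ZR *ᵥ resR eA t) ⬝ᵥ ζ`** (`dotProduct_apply_eq`);
* §2 **`exists_adaptedFrame`** — if `det ZJ` is a unit, the map `M : t ↦ (ZJ·t|κ + ZR·t|ι₂) ⊔ t|ι₂` is a linear AUTOMORPHISM with inverse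
  **`A : t ↦ ZJ⁻¹·(t|κ − ZR·t|ι₂) ⊔ t|ι₂`**, and `A` satisfies (an-2)'s letter `hA`; both formulas are exported (so `(s, b) ↦ A_s(0 ⊔ b) = (−ZJ_s⁻¹ ZR_s b) ⊔ b` is
  visibly rational in the parameters), together with **`LinearMap.det A = (det ZJ)⁻¹`** (the matrix of `M` along `eA` is `fromBlocks ZJ ZR 0 1`).
(an-3) covers `{s ≠ 0}` by finitely many charts on each of which one minor `ZJ_s` is invertible, and feeds `A_s` to ★ (an-2) `integral_partialFourier_graph_eq` ∕
`integral_integral_addChar_linear_mul_slice_eq`; the image `A_s(0 ⊔ F^{ι₂}) = ker Zᵀ_s = s^⊥` is the `t`-fibre of the incidence variety `Z°`, on which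
★ [A4-alg] `K2LiuIsotropicOrthogonalNormClass` gives the class of `⟨t,t⟩`.
Pure linear algebra over any field. [WeilBNT1967, Chap. I §2, Th. 3 Cor. 3] [KudlaRallis1994, §2 (2.10)–(2.12)].
HONEST LABEL.  Count-neutral helper; closes no socket; `HC_CM` is proved only modulo the 7 printed citations (2 remaining named inputs: hLiu418 =
`stmt-HodgeConjecture-24832`, h413 = `stmt-HodgeConjecture-24833`) until rung 0 closes.  NOT here: the chart selection and measurability in `s` ((an-3c)).

## References
* [WeilBNT1967] A. Weil, *Basic Number Theory* (1967), Chap. I §2, Th. 3 Cor. 3 (module of a linear automorphism).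
* [KudlaRallis1994] S. Kudla, S. Rallis, *A regularized Siegel–Weil formula: the first term identity*, Ann. of Math. 140 (1994), §2 (2.10)–(2.12).
-/

set_option autoImplicit false
set_option linter.dupNamespace false -- the mandated namespace repeats `HodgeConjecture.HodgeConjecture`

open Matrix
open Literature.NumberTheory.Automorphic
open Summit.HodgeConjecture.HodgeConjecture.Cruxes.HLiu418

namespace Summit.HodgeConjecture.HodgeConjecture.Cruxes.HLiu418.K2LiuAdaptedFrameOfMinor

variable {F : Type*} [Field F] {κ ι₂ ι₁ : Type*} [Fintype κ] [Fintype ι₂] [Fintype ι₁] [DecidableEq κ] [DecidableEq ι₂] [DecidableEq ι₁]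
  (eA : κ ⊕ ι₂ ≃ ι₁) (Z : (κ → F) →ₗ[F] (ι₁ → F))
  (ZJ : Matrix κ κ F) (hZJ : ∀ k k', ZJ k k' = Z (Pi.single k 1) (eA (Sum.inl k')))
  (ZR : Matrix κ ι₂ F) (hZR : ∀ k j, ZR k j = Z (Pi.single k 1) (eA (Sum.inr j)))

/-! ## §1 The transpose `Zᵀ` in block form along `eA` -/

section Transpose

omit [DecidableEq ι₂] [DecidableEq ι₁] in
include hZJ hZR in
/-- **`t ⬝ᵥ Z e_k = (ZJ·t|κ + ZR·t|ι₂)_k`**: the `k`-th coordinate of `Zᵀ t`, split along `eA`. [cite: WeilBNT1967, Chap. I §2] -/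
theorem dotProduct_apply_single_eq (t : ι₁ → F) (k : κ) :
    t ⬝ᵥ Z (Pi.single k 1) = (ZJ *ᵥ resL eA t + ZR *ᵥ resR eA t) k := by
  conv_lhs => rw [← glue_resL_resR eA t, ← glue_resL_resR eA (Z (Pi.single k 1)), K2LiuLocalPiGlueFubini.dotProduct_glue]
  simp only [Pi.add_apply, mulVec, dotProduct, resL_apply, resR_apply, hZJ, hZR]
  congr 1
  · exact Finset.sum_congr rfl fun k' _ => mul_comm _ _
  · exact Finset.sum_congr rfl fun j _ => mul_comm _ _

omit [DecidableEq ι₂] [DecidableEq ι₁] in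
include hZJ hZR in
/-- **`Zᵀ` IN BLOCK FORM**: `t ⬝ᵥ Z ζ = (ZJ·t|κ + ZR·t|ι₂) ⬝ᵥ ζ` for all `t`, `ζ` (expand `ζ` in the standard basis). [cite: WeilBNT1967, Chap. I §2] -/
theorem dotProduct_apply_eq (t : ι₁ → F) (ζ : κ → F) :
    t ⬝ᵥ Z ζ = (ZJ *ᵥ resL eA t + ZR *ᵥ resR eA t) ⬝ᵥ ζ := by
  have hζ : Z ζ = ∑ k, ζ k • Z (Pi.single k 1) := by
    rw [LinearMap.pi_apply_eq_sum_univ Z ζ]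
    refine Finset.sum_congr rfl fun k _ => ?_
    congr 2
    funext j
    rw [Pi.single_apply]
    by_cases h : k = j
    · rw [if_pos h, if_pos h.symm]
    · rw [if_neg h, if_neg (Ne.symm h)]
  rw [hζ, dotProduct_sum, dotProduct_comm _ ζ, dotProduct]
  refine Finset.sum_congr rfl fun k _ => ?_
  rw [dotProduct_smul, smul_eq_mul, dotProduct_apply_single_eq eA Z ZJ hZJ ZR hZR t k]

end Transpose

/-! ## §2 The adapted frame of an invertible minor -/

section Frame

include hZJ hZR in
/-- **THE ADAPTED FRAME OF AN INVERTIBLE MINOR.**  If the `κ`-minor `ZJ` of `Zᵀ` along `eA` is invertible, there is a linear automorphism `A` of `F^{ι₁}` with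
(i) (an-2)'s frame letter `A t ⬝ᵥ Z ζ = resL eA t ⬝ᵥ ζ` (`Zᵀ ∘ A = pr_κ`), (ii) the explicit formula `A t = ZJ⁻¹·(t|κ − ZR·t|ι₂) ⊔ t|ι₂`, (iii) its inverse
`A⁻¹ t = (ZJ·t|κ + ZR·t|ι₂) ⊔ t|ι₂`, and (iv) `det A = (det ZJ)⁻¹` (the matrix of `A⁻¹` along `eA` is `fromBlocks ZJ ZR 0 1`).  In particular `A(0 ⊔ b) = (−ZJ⁻¹ ZR b) ⊔ b`
parametrises `ker Zᵀ`. [cite: WeilBNT1967, Chap. I §2, Th. 3 Cor. 3] [cite: KudlaRallis1994, §2 (2.10)–(2.12)] -/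
theorem exists_adaptedFrame (hJ : IsUnit ZJ.det) :
    ∃ A : (ι₁ → F) ≃ₗ[F] (ι₁ → F),
      (∀ (t : ι₁ → F) (ζ : κ → F), A t ⬝ᵥ Z ζ = resL eA t ⬝ᵥ ζ) ∧
      (∀ t : ι₁ → F, A t = glue eA (ZJ⁻¹ *ᵥ (resL eA t - ZR *ᵥ resR eA t)) (resR eA t)) ∧
      (∀ t : ι₁ → F, A.symm t = glue eA (ZJ *ᵥ resL eA t + ZR *ᵥ resR eA t) (resR eA t)) ∧
      LinearMap.det (A : (ι₁ → F) →ₗ[F] (ι₁ → F)) = (ZJ.det)⁻¹ := by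
  -- the two mutually inverse maps
  have hleft : ∀ t : ι₁ → F,
      glue eA (ZJ *ᵥ resL eA (glue eA (ZJ⁻¹ *ᵥ (resL eA t - ZR *ᵥ resR eA t)) (resR eA t)) +
          ZR *ᵥ resR eA (glue eA (ZJ⁻¹ *ᵥ (resL eA t - ZR *ᵥ resR eA t)) (resR eA t)))
        (resR eA (glue eA (ZJ⁻¹ *ᵥ (resL eA t - ZR *ᵥ resR eA t)) (resR eA t))) = t := by
    intro t
    rw [resL_glue, resR_glue, mulVec_mulVec, mul_nonsing_inv _ hJ, one_mulVec, sub_add_cancel, glue_resL_resR]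
  have hright : ∀ t : ι₁ → F,
      glue eA (ZJ⁻¹ *ᵥ (resL eA (glue eA (ZJ *ᵥ resL eA t + ZR *ᵥ resR eA t) (resR eA t)) -
          ZR *ᵥ resR eA (glue eA (ZJ *ᵥ resL eA t + ZR *ᵥ resR eA t) (resR eA t))))
        (resR eA (glue eA (ZJ *ᵥ resL eA t + ZR *ᵥ resR eA t) (resR eA t))) = t := by
    intro t
    rw [resL_glue, resR_glue, add_sub_cancel_right, mulVec_mulVec, nonsing_inv_mul _ hJ, one_mulVec, glue_resL_resR]
  let A : (ι₁ → F) ≃ₗ[F] (ι₁ → F) :=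
    { toFun := fun t => glue eA (ZJ⁻¹ *ᵥ (resL eA t - ZR *ᵥ resR eA t)) (resR eA t)
      invFun := fun t => glue eA (ZJ *ᵥ resL eA t + ZR *ᵥ resR eA t) (resR eA t)
      map_add' := fun t t' => by
        rw [glue_add]
        congr 1
        rw [← mulVec_add, resL_add, resR_add, mulVec_add]
        congr 1
        abel
      map_smul' := fun c t => by
        have hsl : resL eA (c • t) = c • resL eA t := rfl
        have hsr : resR eA (c • t) = c • resR eA t := rfl
        rw [RingHom.id_apply, ← K2LiuLocalPiGlueFubini.glue_smul, hsl, hsr, mulVec_smul, ← smul_sub, mulVec_smul]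
      left_inv := fun t => by
        dsimp only
        exact hleft t
      right_inv := fun t => by
        dsimp only
        exact hright t }
  have hAapply : ∀ t, A t = glue eA (ZJ⁻¹ *ᵥ (resL eA t - ZR *ᵥ resR eA t)) (resR eA t) := fun _ => rfl
  have hAsymm : ∀ t, A.symm t = glue eA (ZJ *ᵥ resL eA t + ZR *ᵥ resR eA t) (resR eA t) := fun _ => rfl
  -- the frame letter: `Zᵀ (A t) = t|κ`
  have hframe : ∀ (t : ι₁ → F) (ζ : κ → F), A t ⬝ᵥ Z ζ = resL eA t ⬝ᵥ ζ := by
    intro t ζ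
    rw [dotProduct_apply_eq eA Z ZJ hZJ ZR hZR (A t) ζ, hAapply, resL_glue, resR_glue, mulVec_mulVec, mul_nonsing_inv _ hJ, one_mulVec,
      sub_add_cancel]
  -- the determinant: the matrix of `A⁻¹` along `eA` is block upper triangular with diagonal blocks `ZJ`, `1`
  have hmat : LinearMap.toMatrix' (A.symm : (ι₁ → F) →ₗ[F] (ι₁ → F)) = Matrix.reindex eA eA (Matrix.fromBlocks ZJ ZR 0 1) := by
    ext i i'
    rw [LinearMap.toMatrix'_apply, Matrix.reindex_apply, Matrix.submatrix_apply, LinearEquiv.coe_coe, hAsymm]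
    obtain ⟨x, rfl⟩ := eA.surjective i
    obtain ⟨y, rfl⟩ := eA.surjective i'
    rw [Equiv.symm_apply_apply, Equiv.symm_apply_apply]
    have hL : ∀ y : κ ⊕ ι₂, resL eA (Pi.single (eA y) (1 : F) : ι₁ → F) = fun k => if Sum.inl k = y then 1 else 0 := by
      intro y; funext k
      simp only [resL_apply, Pi.single_apply, eA.injective.eq_iff]
    have hR : ∀ y : κ ⊕ ι₂, resR eA (Pi.single (eA y) (1 : F) : ι₁ → F) = fun j => if Sum.inr j = y then 1 else 0 := by
      intro y; funext j
      simp only [resR_apply, Pi.single_apply, eA.injective.eq_iff]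
    rcases x with k | j <;> rcases y with k' | j'
    · rw [glue_apply_inl, Matrix.fromBlocks_apply₁₁, hL, hR]
      simp [mulVec, dotProduct, mul_ite, Finset.sum_ite_eq']
    · rw [glue_apply_inl, Matrix.fromBlocks_apply₁₂, hL, hR]
      simp [mulVec, dotProduct, mul_ite, Finset.sum_ite_eq']
    · rw [glue_apply_inr, Matrix.fromBlocks_apply₂₁, hR]
      simp
    · rw [glue_apply_inr, Matrix.fromBlocks_apply₂₂, hR]
      simp [Matrix.one_apply]
  have hdetsymm : LinearMap.det (A.symm : (ι₁ → F) →ₗ[F] (ι₁ → F)) = ZJ.det := by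
    rw [← LinearMap.det_toMatrix', hmat, Matrix.det_reindex_self, Matrix.det_fromBlocks_zero₂₁, Matrix.det_one, mul_one]
  have hdet : LinearMap.det (A : (ι₁ → F) →ₗ[F] (ι₁ → F)) = (ZJ.det)⁻¹ := by
    have h := LinearEquiv.det_coe_symm A.symm
    rw [LinearEquiv.symm_symm, hdetsymm] at h
    exact h
  exact ⟨A, hframe, hAapply, hAsymm, hdet⟩

omit [Fintype ι₂] [DecidableEq κ] [DecidableEq ι₂] [DecidableEq ι₁] in
/-- **the kernel of `Zᵀ` is the image of `0 ⊔ F^{ι₂}` under the frame**: for the frame of `exists_adaptedFrame`, `A(0 ⊔ b) ⬝ᵥ Z ζ = 0` for all `b`, `ζ` — the fibre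
coordinate `b` parametrises `ker Zᵀ` (at use: the hyperplane `s^⊥` of the incidence variety). [cite: KudlaRallis1994, §2 (2.10)–(2.12)] -/
theorem frame_glue_zero_dotProduct_apply_eq_zero {A : (ι₁ → F) ≃ₗ[F] (ι₁ → F)}
    (hA : ∀ (t : ι₁ → F) (ζ : κ → F), A t ⬝ᵥ Z ζ = resL eA t ⬝ᵥ ζ) (b : ι₂ → F) (ζ : κ → F) :
    A (glue eA 0 b) ⬝ᵥ Z ζ = 0 := by
  rw [hA, resL_glue, zero_dotProduct]

omit [Fintype ι₁] [DecidableEq ι₂] [DecidableEq ι₁] in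
/-- **explicit fibre point**: with `A` as in `exists_adaptedFrame`, `A(0 ⊔ b) = (−(ZJ⁻¹ * ZR) *ᵥ b) ⊔ b` — rational in the entries of `Z` on `{det ZJ ≠ 0}`.
[cite: WeilBNT1967, Chap. I §2] -/
theorem frame_glue_zero_eq {A : (ι₁ → F) ≃ₗ[F] (ι₁ → F)}
    (hAf : ∀ t : ι₁ → F, A t = glue eA (ZJ⁻¹ *ᵥ (resL eA t - ZR *ᵥ resR eA t)) (resR eA t)) (b : ι₂ → F) :
    A (glue eA 0 b) = glue eA (-((ZJ⁻¹ * ZR) *ᵥ b)) b := by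
  rw [hAf, resL_glue, resR_glue, zero_sub, mulVec_neg, mulVec_mulVec]

end Frame

end Summit.HodgeConjecture.HodgeConjecture.Cruxes.HLiu418.K2LiuAdaptedFrameOfMinor
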